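import Literature.Geometry.Lorentzian.KerrSchild

/-!
# A chronological simplex in Minkowski space and the fitted linear map (quantitative Alexandrov–Zeeman, part 1)

Elementary linear algebra on `E4 = ℝ⁴` with the Minkowski form `η = Minkowski.bilin`, used by the
quantitative Alexandrov–Zeeman lemma (`QuantitativeAlexandrovZeeman.lean`): coordinates and crude
Cauchy–Schwarz for `η` (§0); the CHRONOLOGICAL SIMPLEX `q₁ = 3ℓ∂₀ + (2/5)ℓ∂₁`, `q₂ = 6ℓ∂₀ + (2/5)ℓ∂₂`,
`q₃ = 9ℓ∂₀ + (2/5)ℓ∂₃`, `q₄ = 12ℓ∂₀` (pairwise steeply timelike together with `q₀ = 0`), the coordinate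
functionals `αₐ` of the basis `q₁..q₄`, and PAIRING INVERSION `‖v‖ ≤ 16·maxₐ|η(v, qₐ)|/ℓ` (§1); the
FITTED MAP `A v = Σₐ αₐ(v) fₐ` of a family `f` (in the application `fₐ = k pₐ − k p₀`), its bilinear
expansion, the APPROXIMATE LORENTZ PROPERTY `|η(Av, Aw) − η(v, w)| ≤ 256 ε‖v‖‖w‖/ℓ²` from `ε`-close
Gram data, and INJECTIVITY of approximately Lorentz maps by index raising (§2); steepness test,
polarisation and sizes (§3); packaging as (continuous) linear maps and surjectivity (§4).
Sources: A. D. Alexandrov (1950) and E. C. Zeeman, *Causality implies the Lorentz group*, J. Math.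
Phys. 5 (1964) 490–493 (the exact statement); the quantitative bookkeeping is elementary.  What is NOT
here: any manifold, curve or causal-structure notion.
-/

noncomputable section

open scoped Topology
open Set

namespace Literature.Geometry.Lorentzian.MinkowskiSimplex

/-! ## §0 Coordinates on `E4` -/

/-- `η(v, w) = −v⁰w⁰ + v¹w¹ + v²w² + v³w³` (same normalized statement as the Summits-side
`…Theorems.ClusterCompleteness.minkowski_bilin_apply_four`, which a Literature file cannot import). [folklore] -/
theorem bilin_eq (v w : E4) :
    Minkowski.bilin v w = -(v 0 * w 0) + (v 1 * w 1 + v 2 * w 2 + v 3 * w 3) := by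
  rw [Minkowski.bilin_apply]
  simp [Fin.sum_univ_three]

/-- `‖v‖² = (v⁰)² + (v¹)² + (v²)² + (v³)²` on `E4` (same normalized statement as
`Literature.Geometry.Symplectic.norm_sq_four`; restated to keep the import cone of this Lorentzian
linear-algebra file free of the symplectic handlebody theory). [folklore] -/
theorem norm_sq_eq (v : E4) : ‖v‖ ^ 2 = v 0 ^ 2 + v 1 ^ 2 + v 2 ^ 2 + v 3 ^ 2 := by
  rw [EuclideanSpace.real_norm_sq_eq]
  simp [Fin.sum_univ_four]

/-- Each coordinate is bounded by the norm (same normalized statement as the Summits-side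
`…Theorems.SublinearIsFree.QuasiStationarity.abs_apply_le_norm`, not importable here). [folklore] -/
theorem abs_apply_le_norm (v : E4) (μ : Fin 4) : |v μ| ≤ ‖v‖ := by
  have h := norm_sq_eq v
  have h0 : 0 ≤ ‖v‖ := norm_nonneg v
  rw [← Real.sqrt_sq h0, ← Real.sqrt_sq_eq_abs]
  apply Real.sqrt_le_sqrt
  rw [h]
  fin_cases μ <;> simp <;> nlinarith [sq_nonneg (v 0), sq_nonneg (v 1), sq_nonneg (v 2), sq_nonneg (v 3)]

/-- The norm is bounded by the sum of the absolute coordinates. [folklore] -/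
theorem norm_le_sum_abs (v : E4) : ‖v‖ ≤ |v 0| + |v 1| + |v 2| + |v 3| := by
  have h := norm_sq_eq v
  have h0 : 0 ≤ ‖v‖ := norm_nonneg v
  have hs : 0 ≤ |v 0| + |v 1| + |v 2| + |v 3| := by positivity
  nlinarith [sq_abs (v 0), sq_abs (v 1), sq_abs (v 2), sq_abs (v 3), abs_nonneg (v 0),
    abs_nonneg (v 1), abs_nonneg (v 2), abs_nonneg (v 3)]

/-- `|η(v, w)| ≤ ‖v‖‖w‖·4` (crude Cauchy–Schwarz through coordinates). [folklore] -/
theorem abs_bilin_le (v w : E4) : |Minkowski.bilin v w| ≤ 4 * ‖v‖ * ‖w‖ := by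
  rw [bilin_eq]
  have hv := fun μ ↦ abs_apply_le_norm v μ
  have hw := fun μ ↦ abs_apply_le_norm w μ
  have h0 : |v 0 * w 0| ≤ ‖v‖ * ‖w‖ := by
    rw [abs_mul]; exact mul_le_mul (hv 0) (hw 0) (abs_nonneg _) (norm_nonneg _)
  have h1 : |v 1 * w 1| ≤ ‖v‖ * ‖w‖ := by
    rw [abs_mul]; exact mul_le_mul (hv 1) (hw 1) (abs_nonneg _) (norm_nonneg _)
  have h2 : |v 2 * w 2| ≤ ‖v‖ * ‖w‖ := by
    rw [abs_mul]; exact mul_le_mul (hv 2) (hw 2) (abs_nonneg _) (norm_nonneg _)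
  have h3 : |v 3 * w 3| ≤ ‖v‖ * ‖w‖ := by
    rw [abs_mul]; exact mul_le_mul (hv 3) (hw 3) (abs_nonneg _) (norm_nonneg _)
  have hA : |-(v 0 * w 0) + (v 1 * w 1 + v 2 * w 2 + v 3 * w 3)| ≤
      |v 0 * w 0| + |v 1 * w 1| + |v 2 * w 2| + |v 3 * w 3| := by
    refine abs_le.2 ⟨?_, ?_⟩ <;>
      linarith [neg_abs_le (v 0 * w 0), le_abs_self (v 0 * w 0), neg_abs_le (v 1 * w 1),
        le_abs_self (v 1 * w 1), neg_abs_le (v 2 * w 2), le_abs_self (v 2 * w 2),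
        neg_abs_le (v 3 * w 3), le_abs_self (v 3 * w 3)]
  linarith

/-- Index raising: for `w := (−v⁰, v¹, v², v³)` one has `η(v, w) = ‖v‖²` and `‖w‖ = ‖v‖`; used to show
that an approximately Lorentz map is injective. [folklore] -/
theorem exists_bilin_eq_norm_sq (v : E4) : ∃ w : E4, ‖w‖ = ‖v‖ ∧ Minkowski.bilin v w = ‖v‖ ^ 2 := by
  refine ⟨WithLp.toLp 2 ![-(v 0), v 1, v 2, v 3], ?_, ?_⟩
  · have h1 := norm_sq_eq v
    have h2 := norm_sq_eq (WithLp.toLp 2 ![-(v 0), v 1, v 2, v 3] : E4)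
    simp at h2
    have : ‖(WithLp.toLp 2 ![-(v 0), v 1, v 2, v 3] : E4)‖ ^ 2 = ‖v‖ ^ 2 := by rw [h2, h1]
    exact (sq_eq_sq₀ (norm_nonneg _) (norm_nonneg _)).1 this
  · rw [bilin_eq, norm_sq_eq]
    simp
    ring

/-! ## §1 The chronological simplex `q₁, …, q₄` (scale `ℓ`), coordinates and pairings -/

/-- `q₁ = 3ℓ∂₀ + (2/5)ℓ∂₁`. [folklore] -/
def q1 (ℓ : ℝ) : E4 := WithLp.toLp 2 ![3 * ℓ, 2 / 5 * ℓ, 0, 0]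
/-- `q₂ = 6ℓ∂₀ + (2/5)ℓ∂₂`. [folklore] -/
def q2 (ℓ : ℝ) : E4 := WithLp.toLp 2 ![6 * ℓ, 0, 2 / 5 * ℓ, 0]
/-- `q₃ = 9ℓ∂₀ + (2/5)ℓ∂₃`. [folklore] -/
def q3 (ℓ : ℝ) : E4 := WithLp.toLp 2 ![9 * ℓ, 0, 0, 2 / 5 * ℓ]
/-- `q₄ = 12ℓ∂₀`. [folklore] -/
def q4 (ℓ : ℝ) : E4 := WithLp.toLp 2 ![12 * ℓ, 0, 0, 0]

/-- Coordinate `q₁⁰ = 3ℓ`. [folklore] -/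
@[simp] theorem q1_apply0 (ℓ : ℝ) : q1 ℓ 0 = 3 * ℓ := rfl
/-- Coordinate `q₁¹ = (2/5)ℓ`. [folklore] -/
@[simp] theorem q1_apply1 (ℓ : ℝ) : q1 ℓ 1 = 2 / 5 * ℓ := rfl
/-- Coordinate `q₁² = 0`. [folklore] -/
@[simp] theorem q1_apply2 (ℓ : ℝ) : q1 ℓ 2 = 0 := rfl
/-- Coordinate `q₁³ = 0`. [folklore] -/
@[simp] theorem q1_apply3 (ℓ : ℝ) : q1 ℓ 3 = 0 := rfl
/-- Coordinate `q₂⁰ = 6ℓ`. [folklore] -/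
@[simp] theorem q2_apply0 (ℓ : ℝ) : q2 ℓ 0 = 6 * ℓ := rfl
/-- Coordinate `q₂¹ = 0`. [folklore] -/
@[simp] theorem q2_apply1 (ℓ : ℝ) : q2 ℓ 1 = 0 := rfl
/-- Coordinate `q₂² = (2/5)ℓ`. [folklore] -/
@[simp] theorem q2_apply2 (ℓ : ℝ) : q2 ℓ 2 = 2 / 5 * ℓ := rfl
/-- Coordinate `q₂³ = 0`. [folklore] -/
@[simp] theorem q2_apply3 (ℓ : ℝ) : q2 ℓ 3 = 0 := rfl
/-- Coordinate `q₃⁰ = 9ℓ`. [folklore] -/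
@[simp] theorem q3_apply0 (ℓ : ℝ) : q3 ℓ 0 = 9 * ℓ := rfl
/-- Coordinate `q₃¹ = 0`. [folklore] -/
@[simp] theorem q3_apply1 (ℓ : ℝ) : q3 ℓ 1 = 0 := rfl
/-- Coordinate `q₃² = 0`. [folklore] -/
@[simp] theorem q3_apply2 (ℓ : ℝ) : q3 ℓ 2 = 0 := rfl
/-- Coordinate `q₃³ = (2/5)ℓ`. [folklore] -/
@[simp] theorem q3_apply3 (ℓ : ℝ) : q3 ℓ 3 = 2 / 5 * ℓ := rfl
/-- Coordinate `q₄⁰ = 12ℓ`. [folklore] -/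
@[simp] theorem q4_apply0 (ℓ : ℝ) : q4 ℓ 0 = 12 * ℓ := rfl
/-- Coordinate `q₄¹ = 0`. [folklore] -/
@[simp] theorem q4_apply1 (ℓ : ℝ) : q4 ℓ 1 = 0 := rfl
/-- Coordinate `q₄² = 0`. [folklore] -/
@[simp] theorem q4_apply2 (ℓ : ℝ) : q4 ℓ 2 = 0 := rfl
/-- Coordinate `q₄³ = 0`. [folklore] -/
@[simp] theorem q4_apply3 (ℓ : ℝ) : q4 ℓ 3 = 0 := rfl

/-- Coordinates of `v` in the basis `q₁..q₄`. [folklore] -/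
def α1 (ℓ : ℝ) (v : E4) : ℝ := 5 / (2 * ℓ) * v 1
/-- Coordinates of `v` in the basis `q₁..q₄`. [folklore] -/
def α2 (ℓ : ℝ) (v : E4) : ℝ := 5 / (2 * ℓ) * v 2
/-- Coordinates of `v` in the basis `q₁..q₄`. [folklore] -/
def α3 (ℓ : ℝ) (v : E4) : ℝ := 5 / (2 * ℓ) * v 3
/-- Coordinates of `v` in the basis `q₁..q₄`. [folklore] -/
def α4 (ℓ : ℝ) (v : E4) : ℝ := (v 0 - 15 / 2 * v 1 - 15 * v 2 - 45 / 2 * v 3) / (12 * ℓ)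

/-- `v = Σ αₐ(v) qₐ`. [folklore] -/
theorem decomp (ℓ : ℝ) (hℓ : ℓ ≠ 0) (v : E4) :
    v = α1 ℓ v • q1 ℓ + α2 ℓ v • q2 ℓ + α3 ℓ v • q3 ℓ + α4 ℓ v • q4 ℓ := by
  ext μ
  (fin_cases μ <;> simp [α1, α2, α3, α4] <;> field_simp); ring

/-- Coefficient bounds `|αₐ(v)| ≤ 4‖v‖/ℓ`. [folklore] -/
theorem abs_α_le (ℓ : ℝ) (hℓ : 0 < ℓ) (v : E4) :
    |α1 ℓ v| ≤ 4 * ‖v‖ / ℓ ∧ |α2 ℓ v| ≤ 4 * ‖v‖ / ℓ ∧ |α3 ℓ v| ≤ 4 * ‖v‖ / ℓ ∧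
      |α4 ℓ v| ≤ 4 * ‖v‖ / ℓ := by
  have h0 := abs_apply_le_norm v 0
  have h1 := abs_apply_le_norm v 1
  have h2 := abs_apply_le_norm v 2
  have h3 := abs_apply_le_norm v 3
  have hn := norm_nonneg v
  refine ⟨?_, ?_, ?_, ?_⟩
  · rw [α1, abs_mul, abs_of_pos (by positivity : 0 < 5 / (2 * ℓ))]
    rw [div_mul_eq_mul_div, div_le_div_iff₀ (by positivity) hℓ]; nlinarith
  · rw [α2, abs_mul, abs_of_pos (by positivity : 0 < 5 / (2 * ℓ))]
    rw [div_mul_eq_mul_div, div_le_div_iff₀ (by positivity) hℓ]; nlinarith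
  · rw [α3, abs_mul, abs_of_pos (by positivity : 0 < 5 / (2 * ℓ))]
    rw [div_mul_eq_mul_div, div_le_div_iff₀ (by positivity) hℓ]; nlinarith
  · rw [α4, abs_div, abs_of_pos (by positivity : 0 < 12 * ℓ), div_le_div_iff₀ (by positivity) hℓ]
    have : |v 0 - 15 / 2 * v 1 - 15 * v 2 - 45 / 2 * v 3| ≤ 46 * ‖v‖ := by
      refine abs_le.2 ⟨?_, ?_⟩ <;>
        linarith [neg_abs_le (v 0), le_abs_self (v 0), neg_abs_le (v 1), le_abs_self (v 1),
          neg_abs_le (v 2), le_abs_self (v 2), neg_abs_le (v 3), le_abs_self (v 3)]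
    nlinarith

/-- The four pairings `η(v, qₐ)` in coordinates. [folklore] -/
theorem pairings_eq (ℓ : ℝ) (v : E4) :
    Minkowski.bilin v (q1 ℓ) = -(3 * ℓ) * v 0 + 2 / 5 * ℓ * v 1 ∧
    Minkowski.bilin v (q2 ℓ) = -(6 * ℓ) * v 0 + 2 / 5 * ℓ * v 2 ∧
    Minkowski.bilin v (q3 ℓ) = -(9 * ℓ) * v 0 + 2 / 5 * ℓ * v 3 ∧
    Minkowski.bilin v (q4 ℓ) = -(12 * ℓ) * v 0 := by
  refine ⟨?_, ?_, ?_, ?_⟩ <;> rw [bilin_eq] <;>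
    simp only [q1_apply0, q1_apply1, q1_apply2, q1_apply3, q2_apply0, q2_apply1, q2_apply2, q2_apply3,
      q3_apply0, q3_apply1, q3_apply2, q3_apply3, q4_apply0, q4_apply1, q4_apply2, q4_apply3] <;> ring

/-- Pairing inversion: the four numbers `η(v, qₐ)` control `‖v‖`:
`‖v‖ ≤ 16·max|η(v,qₐ)|/ℓ`. [folklore] -/
theorem norm_le_of_pairings (ℓ : ℝ) (hℓ : 0 < ℓ) (v : E4) (m : ℝ)
    (h1 : |Minkowski.bilin v (q1 ℓ)| ≤ m) (h2 : |Minkowski.bilin v (q2 ℓ)| ≤ m)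
    (h3 : |Minkowski.bilin v (q3 ℓ)| ≤ m) (h4 : |Minkowski.bilin v (q4 ℓ)| ≤ m) :
    ‖v‖ ≤ 16 * m / ℓ := by
  obtain ⟨e1, e2, e3, e4⟩ := pairings_eq ℓ v
  rw [e1] at h1; rw [e2] at h2; rw [e3] at h3; rw [e4] at h4
  rw [abs_le] at h1 h2 h3 h4
  have hm : 0 ≤ m := by linarith [h4.1, h4.2]
  rw [le_div_iff₀ hℓ]
  -- |v 0| ℓ ≤ m/12, |v a| ℓ ≤ 5 m
  have a0 : |v 0| * ℓ ≤ m / 12 := by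
    rcases le_or_gt 0 (v 0) with h | h
    · rw [abs_of_nonneg h]; nlinarith [h4.1, h4.2]
    · rw [abs_of_neg h]; nlinarith [h4.1, h4.2]
  have a1 : |v 1| * ℓ ≤ 5 * m := by
    rcases le_or_gt 0 (v 1) with h | h
    · rw [abs_of_nonneg h]; nlinarith [h1.1, h1.2, a0, abs_nonneg (v 0), neg_abs_le (v 0), le_abs_self (v 0)]
    · rw [abs_of_neg h]; nlinarith [h1.1, h1.2, a0, abs_nonneg (v 0), neg_abs_le (v 0), le_abs_self (v 0)]
  have a2 : |v 2| * ℓ ≤ 5 * m := by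
    rcases le_or_gt 0 (v 2) with h | h
    · rw [abs_of_nonneg h]; nlinarith [h2.1, h2.2, a0, abs_nonneg (v 0), neg_abs_le (v 0), le_abs_self (v 0)]
    · rw [abs_of_neg h]; nlinarith [h2.1, h2.2, a0, abs_nonneg (v 0), neg_abs_le (v 0), le_abs_self (v 0)]
  have a3 : |v 3| * ℓ ≤ 5 * m := by
    rcases le_or_gt 0 (v 3) with h | h
    · rw [abs_of_nonneg h]; nlinarith [h3.1, h3.2, a0, abs_nonneg (v 0), neg_abs_le (v 0), le_abs_self (v 0)]
    · rw [abs_of_neg h]; nlinarith [h3.1, h3.2, a0, abs_nonneg (v 0), neg_abs_le (v 0), le_abs_self (v 0)]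
  have hs := norm_le_sum_abs v
  have : (|v 0| + |v 1| + |v 2| + |v 3|) * ℓ ≤ 16 * m := by nlinarith
  calc ‖v‖ * ℓ ≤ (|v 0| + |v 1| + |v 2| + |v 3|) * ℓ := mul_le_mul_of_nonneg_right hs hℓ.le
    _ ≤ 16 * m := this

/-! ## §2 Families indexed by `Fin 4`, the fitted linear map `A`, approximate Lorentz property -/

/-- The simplex edge vectors as a family. [folklore] -/
def qv (ℓ : ℝ) : Fin 4 → E4 := ![q1 ℓ, q2 ℓ, q3 ℓ, q4 ℓ]

/-- The coordinate functionals as a family. [folklore] -/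
def αv (ℓ : ℝ) (v : E4) : Fin 4 → ℝ := ![α1 ℓ v, α2 ℓ v, α3 ℓ v, α4 ℓ v]

/-- `v = Σₐ αₐ(v) qₐ` (family form). [folklore] -/
theorem decomp_sum (ℓ : ℝ) (hℓ : ℓ ≠ 0) (v : E4) : v = ∑ a : Fin 4, αv ℓ v a • qv ℓ a := by
  rw [Fin.sum_univ_four]
  simpa [αv, qv] using decomp ℓ hℓ v

/-- `|αₐ(v)| ≤ 4‖v‖/ℓ` (family form). [folklore] -/
theorem abs_αv_le (ℓ : ℝ) (hℓ : 0 < ℓ) (v : E4) (a : Fin 4) : |αv ℓ v a| ≤ 4 * ‖v‖ / ℓ := by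
  obtain ⟨h1, h2, h3, h4⟩ := abs_α_le ℓ hℓ v
  fin_cases a <;> simpa [αv]

/-- The coordinate functionals are linear: additive. [folklore] -/
theorem αv_add (ℓ : ℝ) (v w : E4) (a : Fin 4) : αv ℓ (v + w) a = αv ℓ v a + αv ℓ w a := by
  fin_cases a <;> simp [αv, α1, α2, α3, α4] <;> ring

/-- The coordinate functionals are linear: homogeneous. [folklore] -/
theorem αv_smul (ℓ : ℝ) (c : ℝ) (v : E4) (a : Fin 4) : αv ℓ (c • v) a = c * αv ℓ v a := by
  fin_cases a <;> simp [αv, α1, α2, α3, α4] <;> ring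

/-- The FITTED MAP `A v := Σₐ αₐ(v) fₐ` for a family `f` (in the proof `fₐ = k pₐ − k p₀`), as a plain
function; it is linear (`mapA_add`, `mapA_smul`) and `A qₐ = fₐ`. [folklore] -/
def mapA (ℓ : ℝ) (f : Fin 4 → E4) (v : E4) : E4 := ∑ a : Fin 4, αv ℓ v a • f a

/-- The fitted map is additive. [folklore] -/
theorem mapA_add (ℓ : ℝ) (f : Fin 4 → E4) (v w : E4) : mapA ℓ f (v + w) = mapA ℓ f v + mapA ℓ f w := by
  simp only [mapA, αv_add, add_smul, Finset.sum_add_distrib]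

/-- The fitted map is homogeneous. [folklore] -/
theorem mapA_smul (ℓ : ℝ) (f : Fin 4 → E4) (c : ℝ) (v : E4) : mapA ℓ f (c • v) = c • mapA ℓ f v := by
  simp only [mapA, αv_smul, mul_smul, Finset.smul_sum]

/-- The fitted map respects subtraction. [folklore] -/
theorem mapA_sub (ℓ : ℝ) (f : Fin 4 → E4) (v w : E4) : mapA ℓ f (v - w) = mapA ℓ f v - mapA ℓ f w := by
  rw [sub_eq_add_neg, mapA_add, ← neg_one_smul ℝ w, mapA_smul]; simp [sub_eq_add_neg]

/-- `αᵦ(qₐ) = δ_{ab}`. [folklore] -/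
theorem αv_qv (ℓ : ℝ) (hℓ : ℓ ≠ 0) (a b : Fin 4) : αv ℓ (qv ℓ a) b = if a = b then 1 else 0 := by
  fin_cases a <;> fin_cases b <;> simp [αv, qv, α1, α2, α3, α4, q1, q2, q3, q4, hℓ] <;>
    (try field_simp) <;> ring

/-- `A qₐ = fₐ`. [folklore] -/
theorem mapA_qv (ℓ : ℝ) (hℓ : ℓ ≠ 0) (f : Fin 4 → E4) (a : Fin 4) : mapA ℓ f (qv ℓ a) = f a := by
  simp only [mapA, αv_qv ℓ hℓ]
  simp [Finset.sum_ite_eq, Finset.mem_univ]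

/-- Bilinear expansion: `B (A v) (A w) = Σₐ Σᵦ αₐ(v) αᵦ(w) B(fₐ, fᵦ)`. [folklore] -/
theorem bilin_mapA_mapA (B : E4 →L[ℝ] E4 →L[ℝ] ℝ) (ℓ : ℝ) (f : Fin 4 → E4) (v w : E4) :
    B (mapA ℓ f v) (mapA ℓ f w) = ∑ a : Fin 4, ∑ b : Fin 4, αv ℓ v a * αv ℓ w b * B (f a) (f b) := by
  simp only [mapA, map_sum, map_smul, FunLike.coe_sum, Finset.sum_apply, FunLike.coe_smul, Pi.smul_apply,
    smul_eq_mul, Finset.mul_sum]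
  rw [Finset.sum_comm]
  refine Finset.sum_congr rfl fun a _ ↦ Finset.sum_congr rfl fun b _ ↦ ?_
  ring

/-- The same expansion for the domain form: `η(v, w) = Σₐ Σᵦ αₐ(v) αᵦ(w) η(qₐ, qᵦ)`. [folklore] -/
theorem bilin_eq_sum_αv (ℓ : ℝ) (hℓ : ℓ ≠ 0) (v w : E4) :
    Minkowski.bilin v w = ∑ a : Fin 4, ∑ b : Fin 4, αv ℓ v a * αv ℓ w b * Minkowski.bilin (qv ℓ a) (qv ℓ b) := by
  have hv : mapA ℓ (qv ℓ) v = v := by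
    rw [mapA]; exact (decomp_sum ℓ hℓ v).symm
  have hw : mapA ℓ (qv ℓ) w = w := by
    rw [mapA]; exact (decomp_sum ℓ hℓ w).symm
  conv_lhs => rw [← hv, ← hw]
  exact bilin_mapA_mapA Minkowski.bilin ℓ (qv ℓ) v w

/-- **Approximate Lorentz property of the fitted map**: if the Gram data of the image family are
`ε`-close to those of the simplex, `|η(fₐ,fᵦ) − η(qₐ,qᵦ)| ≤ ε`, then
`|η(Av, Aw) − η(v, w)| ≤ 256 ε ‖v‖‖w‖/ℓ²`. [folklore] -/
theorem abs_bilin_mapA_sub_le (ℓ : ℝ) (hℓ : 0 < ℓ) (f : Fin 4 → E4) (ε : ℝ)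
    (hG : ∀ a b : Fin 4, |Minkowski.bilin (f a) (f b) - Minkowski.bilin (qv ℓ a) (qv ℓ b)| ≤ ε)
    (v w : E4) :
    |Minkowski.bilin (mapA ℓ f v) (mapA ℓ f w) - Minkowski.bilin v w| ≤ 256 * ε * ‖v‖ * ‖w‖ / ℓ ^ 2 := by
  have hε : 0 ≤ ε := (abs_nonneg _).trans (hG 0 0)
  rw [bilin_mapA_mapA, bilin_eq_sum_αv ℓ hℓ.ne' v w, ← Finset.sum_sub_distrib]
  simp_rw [← Finset.sum_sub_distrib, ← mul_sub]
  have hterm : ∀ a b : Fin 4,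
      |αv ℓ v a * αv ℓ w b * (Minkowski.bilin (f a) (f b) - Minkowski.bilin (qv ℓ a) (qv ℓ b))| ≤
        (4 * ‖v‖ / ℓ) * (4 * ‖w‖ / ℓ) * ε := by
    intro a b
    rw [abs_mul, abs_mul]
    refine mul_le_mul (mul_le_mul (abs_αv_le ℓ hℓ v a) (abs_αv_le ℓ hℓ w b) (abs_nonneg _)
      (by positivity)) (hG a b) (abs_nonneg _) (by positivity)
  calc |∑ a : Fin 4, ∑ b : Fin 4,
        αv ℓ v a * αv ℓ w b * (Minkowski.bilin (f a) (f b) - Minkowski.bilin (qv ℓ a) (qv ℓ b))|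
      ≤ ∑ a : Fin 4, ∑ b : Fin 4,
        |αv ℓ v a * αv ℓ w b * (Minkowski.bilin (f a) (f b) - Minkowski.bilin (qv ℓ a) (qv ℓ b))| := by
        refine (Finset.abs_sum_le_sum_abs _ _).trans (Finset.sum_le_sum fun a _ ↦ ?_)
        exact Finset.abs_sum_le_sum_abs _ _
    _ ≤ ∑ _a : Fin 4, ∑ _b : Fin 4, (4 * ‖v‖ / ℓ) * (4 * ‖w‖ / ℓ) * ε :=
        Finset.sum_le_sum fun a _ ↦ Finset.sum_le_sum fun b _ ↦ hterm a b
    _ = 256 * ε * ‖v‖ * ‖w‖ / ℓ ^ 2 := by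
        simp only [Finset.sum_const, Finset.card_univ, Fintype.card_fin, nsmul_eq_mul]
        field_simp; ring

/-- **An approximately Lorentz linear map is injective** (index raising): if
`|η(Av, Aw) − η(v, w)| ≤ c‖v‖‖w‖` with `c < 1` then `A v = 0 ⇒ v = 0`. [folklore] -/
theorem eq_zero_of_mapA_eq_zero (ℓ : ℝ) (f : Fin 4 → E4) (c : ℝ) (hc : c < 1)
    (hA : ∀ v w, |Minkowski.bilin (mapA ℓ f v) (mapA ℓ f w) - Minkowski.bilin v w| ≤ c * ‖v‖ * ‖w‖)
    (v : E4) (hv : mapA ℓ f v = 0) : v = 0 := by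
  obtain ⟨w, hw, hvw⟩ := exists_bilin_eq_norm_sq v
  have h := hA v w
  rw [hv, map_zero, zero_apply, zero_sub, abs_neg, hvw, hw,
    abs_of_nonneg (by positivity)] at h
  have : ‖v‖ ^ 2 * (1 - c) ≤ 0 := by nlinarith
  have h2 : ‖v‖ ^ 2 ≤ 0 := by
    by_contra h3
    push Not at h3
    nlinarith
  have : ‖v‖ = 0 := by nlinarith [norm_nonneg v]
  exact norm_eq_zero.1 this

/-! ## §3 Steepness, polarisation, sizes -/

/-- Steepness from coordinates: `5(v¹² + v²² + v³²) ≤ 3 v⁰² ⇒ η(v,v) ≤ −¼‖v‖²`. [folklore] -/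
theorem steep_of (v : E4) (h : 5 * (v 1 ^ 2 + v 2 ^ 2 + v 3 ^ 2) ≤ 3 * v 0 ^ 2) :
    Minkowski.bilin v v ≤ -(1 / 4) * ‖v‖ ^ 2 := by
  rw [bilin_eq, norm_sq_eq]; nlinarith

/-- `|η(v, v)| ≤ 4‖v‖²`. [folklore] -/
theorem abs_bilin_self_le (v : E4) : |Minkowski.bilin v v| ≤ 4 * ‖v‖ ^ 2 := by
  have := abs_bilin_le v v; nlinarith [norm_nonneg v]

/-- Polarisation for `η`: `η(v, w) = ½(η(v,v) + η(w,w) − η(v − w, v − w))`. [folklore] -/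
theorem bilin_polar (v w : E4) :
    Minkowski.bilin v w =
      1 / 2 * (Minkowski.bilin v v + Minkowski.bilin w w - Minkowski.bilin (v - w) (v - w)) := by
  simp only [map_sub, sub_apply, Minkowski.bilin_symm w v]; ring

/-- The unit time vector `∂₀ = (1,0,0,0)`. [folklore] -/
def bv0 : E4 := WithLp.toLp 2 ![1, 0, 0, 0]

/-- Coordinate `∂₀⁰ = 1`. [folklore] -/
@[simp] theorem bv0_apply0 : bv0 0 = 1 := rfl
/-- Coordinate `∂₀¹ = 0`. [folklore] -/
@[simp] theorem bv0_apply1 : bv0 1 = 0 := rfl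
/-- Coordinate `∂₀² = 0`. [folklore] -/
@[simp] theorem bv0_apply2 : bv0 2 = 0 := rfl
/-- Coordinate `∂₀³ = 0`. [folklore] -/
@[simp] theorem bv0_apply3 : bv0 3 = 0 := rfl

/-- Coordinates of the family `qv`. [folklore] -/
theorem qv_apply (ℓ : ℝ) (a : Fin 4) :
    qv ℓ a 0 = 3 * ((a : ℕ) + 1) * ℓ ∧ |qv ℓ a 1| ≤ 2 / 5 * |ℓ| ∧ |qv ℓ a 2| ≤ 2 / 5 * |ℓ| ∧
      |qv ℓ a 3| ≤ 2 / 5 * |ℓ| := by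
  fin_cases a <;> simp [qv, q1, q2, q3, q4, abs_mul] <;> norm_num

/-- Size of the simplex edges: `‖qv a‖ ≤ 13ℓ`. [folklore] -/
theorem norm_qv_le (ℓ : ℝ) (hℓ : 0 < ℓ) (a : Fin 4) : ‖qv ℓ a‖ ≤ 13 * ℓ := by
  have h := norm_sq_eq (qv ℓ a)
  have key : ‖qv ℓ a‖ ^ 2 ≤ (13 * ℓ) ^ 2 := by
    rw [h]; fin_cases a <;> simp [qv, q1, q2, q3, q4] <;> nlinarith
  exact (abs_le_of_sq_le_sq' key (by positivity)).2

/-! ## §4 Packaging the fitted map; surjectivity -/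

/-- The fitted map as a linear map. [folklore] -/
def mapAL (ℓ : ℝ) (f : Fin 4 → E4) : E4 →ₗ[ℝ] E4 where
  toFun := mapA ℓ f
  map_add' := mapA_add ℓ f
  map_smul' := mapA_smul ℓ f

/-- The linear-map packaging agrees with `mapA`. [folklore] -/
@[simp] theorem mapAL_apply (ℓ : ℝ) (f : Fin 4 → E4) (v : E4) : mapAL ℓ f v = mapA ℓ f v := rfl

/-- The fitted map as a continuous linear map (finite dimension). [folklore] -/
def mapAC (ℓ : ℝ) (f : Fin 4 → E4) : E4 →L[ℝ] E4 := LinearMap.toContinuousLinearMap (mapAL ℓ f)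

/-- The continuous-linear-map packaging agrees with `mapA`. [folklore] -/
@[simp] theorem mapAC_apply (ℓ : ℝ) (f : Fin 4 → E4) (v : E4) : mapAC ℓ f v = mapA ℓ f v := rfl

/-- An approximately Lorentz fitted map (constant `c < 1`) is surjective. [folklore] -/
theorem mapA_surjective (ℓ : ℝ) (f : Fin 4 → E4) (c : ℝ) (hc : c < 1)
    (hA : ∀ v w, |Minkowski.bilin (mapA ℓ f v) (mapA ℓ f w) - Minkowski.bilin v w| ≤ c * ‖v‖ * ‖w‖) :
    Function.Surjective (mapA ℓ f) := by
  have hinj : Function.Injective (mapAL ℓ f) := by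
    intro v w h
    have h' : mapA ℓ f (v - w) = 0 := by
      rw [mapA_sub]; exact sub_eq_zero.2 h
    exact sub_eq_zero.1 (eq_zero_of_mapA_eq_zero ℓ f c hc hA (v - w) h')
  exact LinearMap.injective_iff_surjective.1 hinj


end Literature.Geometry.Lorentzian.MinkowskiSimplex

end
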